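import Summits.BirchSwinnertonDyer.Rank1Residual.Ordinary.Conjectures.KolyvaginKimDatumOfKolyvaginSystemAnyModulus
import Summits.BirchSwinnertonDyer.Rank1Residual.GaloisImage.CanonicalKolyvaginDatumAdmissibleDeep
import HarnessLib

/-!
# The Kolyvagin-class datum from a Kolyvagin system for THE CANONICAL comparison maps: admissibility DISCHARGED by the
# tree's Mazur–Rubin Lemma 1.2.3 (team n1011) — the junction, as theorems (nothing asserted; C-16 stays a CONJECTURE)

HONEST FRAMING (cell `b2b-bsdres`, run/shared/lean/b2b/bsd-rank1-residual/, verbatim in every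
file): the goal of the cell is to DELETE the COMBINATION-SHAPED residual classes of the
Birch–Swinnerton-Dyer formula for ALL analytic-rank `≤ 1` elliptic curves over `ℚ` — "full BSD
formula for every rank `≤ 1` curve in class `C`" assembled STRICTLY from published theorems — so
that the rank-`≤ 1` remainder becomes exactly the CONSTRUCTION-SHAPED classes, which are TYPED
(missing-input `Prop`s), NOT attempted. This is not "finishing BSD". Seat `b2b-bsdres-additive-p3`
(X8 prover B / X7 joint; typer-designate for the cell conjecture C-16 = hyp C120.1; ladder BSD:K3 hand-off to cell
`bsd-ssimc`). This file books nothing and moves no mark; X7 / X8 stay CONSTRUCTION-SHAPED; C-16 = CONJECTURE.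

## What this file does

`KolyvaginKimDatumOfKolyvaginSystemAnyModulus.lean` derives the ONE residual input of C-16 (`KolyvaginKimDatum`) from a Kolyvagin
system of the tree's vocabulary on `E[p^k·p]`, given that the comparison map `φ^{fs}_{vℓ}` of the datum is bijective on
`H¹_ur` (admissible). For a datum carrying THE CANONICAL comparison maps (`KolyvaginDatum.HasCanonicalComparison`, Rubin
Def. 1.9.6 = Mazur–Rubin Def. 1.2.2 in Kim's generator-fixed form) whose primes lie in Sakamoto's `τ`-class
(`frobeniusClassPrimes`, with `E[p^{k+1}]/(τ − 1) ≅ ℤ/p^{k+1}` and `τ` fixing `μ_{p^{k+1}}`), admissibility is a THEOREM of the tree —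
Mazur–Rubin Lemma 1.2.3 / Rubin Ex. 1.9.7, team n1011's `GaloisImage/CanonicalKolyvaginDatumAdmissible{,PrimePow,Deep}.lean`
(`FSComp.isAdmissible_of_hasCanonicalComparison_of_subset_primePow`). This file composes the two (no transport of any kind:
both sides spell the module `W.torsionGaloisModule ((p : ℤ) ^ k * p)`):

* `kolyvaginKimDatum_of_isKolyvaginSystem_canonical` — any prime `p`: a Kolyvagin system for a CANONICAL datum on `E[p^k·p]`
  with primes in Sakamoto's `τ`-class, `κ_1 = κ(Q)`, `𝓕 ≤ Kummer` off `{vℓ, vp}`, Kim's reading ⟹ `KolyvaginKimDatum … (k+1) …`;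
* `kolyvaginKimDatum_of_isKolyvaginSystem_canonical_deep` — the N11 spelling at `p = 3` with the DEEP prime class
  (`isAdmissible_of_hasCanonicalComparison_torsion_deep`);
* `kuriharaExactOrderRankOneAtThree_of_isKolyvaginSystem_canonical` — the closed sentence: **C-16 ⟸ Poitou–Tate ∧ local Euler
  characteristic ∧ (on every letter: a Kolyvagin system for THE CANONICAL datum on `E[3^{k′}·3]` — primes in a Sakamoto
  `τ`-class — with `κ_1 = κ((3^F·u)·P)` and Kim's reading)**; the comparison maps are no longer a hypothesis of any kind —
  what is displayed is exactly «Kato's classes form such a Kolyvagin system» (Kato + Mazur–Rubin Thm. 3.2.4 / 5.2.12; the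
  tree's THEOREM D `GaloisImage/KolyvaginSystemOfEulerSystem.lean` produces it from an Euler system of `T_pE`, `S`-places
  displayed) and «Kim's reading» (Thm. 3.13 + (5.3)) — print for `p ≥ 5`, OPEN at `p = 3`.

References: B. Mazur, K. Rubin, Mem. AMS 799 (2004), Def. 1.2.2, Lemma 1.2.3, Thm. 3.2.4, Thm. 5.2.12 [MazurRubin2004];
K. Rubin, PCMI 18 (2011) Def. 1.9.6, Ex. 1.9.7 [Rubin2011]; R. Sakamoto, JTNB 36 (2024) §2 (the set `𝒫`, (H.2)), Def. 4.1
[Sakamoto2024]; C.-H. Kim, arXiv:2203.12159, §2.2.2, Thm. 3.13, (5.3) [Kim2022StructureSelmer]; J. S. Milne, ADT (2006) I 2.8,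
4.10(b) [MilneADT2006]; `HOME/b2b-bsdres-additive-p3/HANDOFF-TO-bsd-ssimc-K3.md` §2.
-/

noncomputable section

open scoped Classical MatrixGroups

open CongruenceSubgroup WeierstrassCurve Literature.NumberTheory.EllipticCurves
  Literature.NumberTheory.EllipticCurves.ModularForms
  Literature.NumberTheory.EllipticCurves.Rank1Residual
  Literature.NumberTheory.GaloisRepresentations Literature.NumberTheory.GaloisCohomology
  Literature.NumberTheory.GaloisRepresentations.DiscreteGaloisModule
  Function NumberField IsDedekindDomain Field
  Summit.BirchSwinnertonDyer.Rank1Residual.GaloisImage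

namespace Summit.BirchSwinnertonDyer.Rank1Residual.Ordinary

/-! ### §1 Any prime `p`: primes in a Sakamoto `τ`-class, canonical comparison maps -/

section Canonical

variable (W : WeierstrassCurve ℚ) [W.IsElliptic] {N : ℕ} (f : CuspForm (Gamma0 N) 2)
  (p ℓ k₀ k : ℕ) [Fact p.Prime] [Fact ℓ.Prime] (Q : W.toAffine.Point) (vℓ vp : HeightOneSpectrum (𝓞 ℚ))
  (ψ : (q : ℕ) → (ZMod q)ˣ →* Multiplicative (ZMod (p ^ k₀)))

/-- **`KolyvaginKimDatum` at depth `k + 1` from a Kolyvagin system for THE CANONICAL datum on `E[p^k·p]`.** Data: `S`,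
Sakamoto's `τ ∈ Gal(ℚ̄/ℚ(μ_{p^{k+1}}))` with `E[p^{k+1}]/(τ − 1) ≅ ℤ/p^{k+1}` ((H.2)); a Kolyvagin datum `D` whose primes lie in
the `τ`-class `frobeniusClassPrimes _ S τ p^{k+1}` and whose comparison maps are THE canonical ones for primitive roots `ηr`
(`HasCanonicalComparison`) — then `D.IsAdmissible` is the tree's Mazur–Rubin Lemma 1.2.3
(`FSComp.isAdmissible_of_hasCanonicalComparison_of_subset_primePow`); `vℓ ∈ 𝒫`, `vℓ ∤ p` good; `𝓕 ≤ Kummer` off `{vℓ, vp}`;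
a Kolyvagin system `κ` with `κ_1 = κ(Q)`; Kim's reading of `κ_{ℓ}`. [cite: MazurRubin2004, Lemma 1.2.3, Thm. 3.2.4 and Thm. 5.2.12]
[cite: Sakamoto2024, §2 (p. 921) and Def. 4.1 (p. 926)] [cite: Kim2022StructureSelmer, §2.2.2 and Thm. 3.13] -/
theorem kolyvaginKimDatum_of_isKolyvaginSystem_canonical
    (S : Set (HeightOneSpectrum (𝓞 ℚ))) {τ : absoluteGaloisGroup ℚ}
    (hτq : Nonempty (cokerSubOne (W.torsionGaloisModule ((p : ℤ) ^ k * (p : ℤ))) τ ≃+ ZMod (p ^ (k + 1))))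
    (hτμ : τ ∈ rootsOfUnityFixer ℚ (p ^ (k + 1)))
    {D : KolyvaginDatum (W.torsionGaloisModule ((p : ℤ) ^ k * (p : ℤ)))}
    (hP : D.primes ⊆ frobeniusClassPrimes (W.torsionGaloisModule ((p : ℤ) ^ k * (p : ℤ))) S τ (p ^ (k + 1)))
    {ηr : (q : HeightOneSpectrum (𝓞 ℚ)) → (ZMod (Ideal.absNorm q.asIdeal))ˣ}
    (hD : D.HasCanonicalComparison (p ^ (k + 1)) ηr) (hDℓ : vℓ ∈ D.primes)
    (hdiv : ∀ P : geomPoints W, ∃ R : geomPoints W, ((p : ℤ) ^ k * (p : ℤ)) • R = P)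
    (hpv : ((p : ℕ) : 𝓞 ℚ) ∉ vℓ.asIdeal) (hgood : W.HasGoodReductionAt vℓ)
    {𝓕 : SelmerStructure (W.torsionGaloisModule ((p : ℤ) ^ k * (p : ℤ)))}
    (h𝓕 : ∀ v : Place ℚ, v ≠ Sum.inr vℓ → v ≠ Sum.inr vp →
      𝓕 v ≤ W.kummerSelmerStructure ((p : ℤ) ^ k * (p : ℤ)) v)
    {κ : Finset (HeightOneSpectrum (𝓞 ℚ)) → galoisCohomology (W.torsionGaloisModule ((p : ℤ) ^ k * (p : ℤ))) 1}
    (hκ : D.IsKolyvaginSystem 𝓕 κ) (h1 : κ ∅ = kummerMapTorsion W ((p : ℤ) ^ k * (p : ℤ)) hdiv Q)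
    (hkim : ∀ ψp : galoisCohomology ((W.torsionGaloisModule ((p : ℤ) ^ k * (p : ℤ))).toLocal (Sum.inr vp)) 1 ⧸
        W.kummerSelmerStructure ((p : ℤ) ^ k * (p : ℤ)) (Sum.inr vp) ≃+ ZMod (p ^ (k + 1)),
      (haveI : NeZero ℓ := ⟨(Fact.out : ℓ.Prime).ne_zero⟩
       zmodPowOrd p k₀ (kuriharaNumber f (p ^ k₀) ℓ ψ)) =
        min k₀ (zmodPowOrd p (k + 1)
          (ψp (galoisCohomology.localization (W.torsionGaloisModule ((p : ℤ) ^ k * (p : ℤ))) (Sum.inr vp) 1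
            (κ {vℓ}))))) :
    KolyvaginKimDatum W f p ℓ k₀ (k + 1) Q vℓ vp ψ :=
  kolyvaginKimDatum_of_isKolyvaginSystem_powMul W f p ℓ k₀ k Q vℓ vp ψ hdiv hpv hgood hDℓ
    ((FSComp.isAdmissible_of_hasCanonicalComparison_of_subset_primePow
      (W.torsionGaloisModule ((p : ℤ) ^ k * (p : ℤ))) p (k + 1) S hτq hτμ hP hD) vℓ hDℓ) h𝓕 hκ h1 hkim

end Canonical

/-! ### §2 The N11 spelling at `p = 3` with the DEEP prime class -/

section Deep

variable (W : WeierstrassCurve ℚ) [W.IsElliptic] {N : ℕ} (f : CuspForm (Gamma0 N) 2)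
  (ℓ k₀ k k' : ℕ) [Fact ℓ.Prime] (Q : W.toAffine.Point) (vℓ v₃ : HeightOneSpectrum (𝓞 ℚ))
  (ψ : (q : ℕ) → (ZMod q)ˣ →* Multiplicative (ZMod (3 ^ k₀)))

/-- **`KolyvaginKimDatum` at `p = 3`, depth `k + 1`, from a Kolyvagin system for the canonical DEEP datum on `E[3^k·3]`**
(primes = the `τ`-class cut out through `E[3^{k′+1}]` at `3^{k′+1}`, `k ≤ k′`; admissibility by the tree's
`isAdmissible_of_hasCanonicalComparison_torsion_deep`). [cite: MazurRubin2004, Lemma 1.2.3 and Thm. 3.2.4]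
[cite: Sakamoto2024, §2 (p. 921)] [cite: Kim2022StructureSelmer, Thm. 3.13] -/
theorem kolyvaginKimDatum_of_isKolyvaginSystem_canonical_deep [Fact (Nat.Prime 3)] (hk : k ≤ k')
    (S : Set (HeightOneSpectrum (𝓞 ℚ))) {τ : absoluteGaloisGroup ℚ}
    (hτμ : τ ∈ rootsOfUnityFixer ℚ (3 ^ (k' + 1)))
    (hτq : Nonempty (cokerSubOne (W.torsionGaloisModule (((3 : ℕ) : ℤ) ^ k * ((3 : ℕ) : ℤ))) τ ≃+ ZMod (3 ^ (k + 1))))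
    {D : KolyvaginDatum (W.torsionGaloisModule (((3 : ℕ) : ℤ) ^ k * ((3 : ℕ) : ℤ)))}
    (hP : D.primes = frobeniusClassPrimes (W.torsionGaloisModule (((3 : ℕ) : ℤ) ^ k' * ((3 : ℕ) : ℤ)))
      S τ (3 ^ (k' + 1)))
    {ηr : (q : HeightOneSpectrum (𝓞 ℚ)) → (ZMod (Ideal.absNorm q.asIdeal))ˣ}
    (hD : D.HasCanonicalComparison (3 ^ (k + 1)) ηr) (hDℓ : vℓ ∈ D.primes)
    (hdiv : ∀ P : geomPoints W, ∃ R : geomPoints W, (((3 : ℕ) : ℤ) ^ k * ((3 : ℕ) : ℤ)) • R = P)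
    (hpv : ((3 : ℕ) : 𝓞 ℚ) ∉ vℓ.asIdeal) (hgood : W.HasGoodReductionAt vℓ)
    {𝓕 : SelmerStructure (W.torsionGaloisModule (((3 : ℕ) : ℤ) ^ k * ((3 : ℕ) : ℤ)))}
    (h𝓕 : ∀ v : Place ℚ, v ≠ Sum.inr vℓ → v ≠ Sum.inr v₃ →
      𝓕 v ≤ W.kummerSelmerStructure (((3 : ℕ) : ℤ) ^ k * ((3 : ℕ) : ℤ)) v)
    {κ : Finset (HeightOneSpectrum (𝓞 ℚ)) →
      galoisCohomology (W.torsionGaloisModule (((3 : ℕ) : ℤ) ^ k * ((3 : ℕ) : ℤ))) 1}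
    (hκ : D.IsKolyvaginSystem 𝓕 κ)
    (h1 : κ ∅ = kummerMapTorsion W (((3 : ℕ) : ℤ) ^ k * ((3 : ℕ) : ℤ)) hdiv Q)
    (hkim : ∀ ψp : galoisCohomology ((W.torsionGaloisModule (((3 : ℕ) : ℤ) ^ k * ((3 : ℕ) : ℤ))).toLocal
        (Sum.inr v₃)) 1 ⧸ W.kummerSelmerStructure (((3 : ℕ) : ℤ) ^ k * ((3 : ℕ) : ℤ)) (Sum.inr v₃) ≃+ ZMod (3 ^ (k + 1)),
      (haveI : NeZero ℓ := ⟨(Fact.out : ℓ.Prime).ne_zero⟩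
       zmodPowOrd 3 k₀ (kuriharaNumber f (3 ^ k₀) ℓ ψ)) =
        min k₀ (zmodPowOrd 3 (k + 1) (ψp (galoisCohomology.localization
          (W.torsionGaloisModule (((3 : ℕ) : ℤ) ^ k * ((3 : ℕ) : ℤ))) (Sum.inr v₃) 1 (κ {vℓ}))))) :
    KolyvaginKimDatum W f 3 ℓ k₀ (k + 1) Q vℓ v₃ ψ :=
  kolyvaginKimDatum_of_isKolyvaginSystem_powMul W f 3 ℓ k₀ k Q vℓ v₃ ψ hdiv hpv hgood hDℓ
    ((isAdmissible_of_hasCanonicalComparison_torsion_deep W k k' hk S hτμ hτq hP hD) vℓ hDℓ) h𝓕 hκ h1 hkim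

end Deep

/-! ### §3 The closed sentence with THE CANONICAL comparison maps (admissibility discharged) -/

section Closed

/-- **C-16 (closed sentence) ⟸ Poitou–Tate over `ℚ` ∧ local Euler characteristic at every `ℚ_v` ∧, on C-16's letter,
a KOLYVAGIN SYSTEM FOR THE CANONICAL DATUM with Kim's reading.** For every surjective `ψ`: a depth `k′ + 1 ≥ k` with
`ℓ ∈ 𝒫_{k′+1}`, a unit `u` (`3 ∤ u`), a finite-place set `S` and Sakamoto's `τ ∈ Gal(ℚ̄/ℚ(μ_{3^{k′+1}}))` with
`E[3^{k′+1}]/(τ − 1) ≅ ℤ/3^{k′+1}`, a Kolyvagin datum `KD` on `E[3^{k′}·3]` with primes in the `τ`-class and THE CANONICAL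
comparison maps for primitive roots `ηr` (`HasCanonicalComparison`), `vℓ ∈ KD.primes`, a divisibility witness, a Selmer
structure Kummer-or-finer off `{vℓ, v₃}`, and a Kolyvagin system `κ` for `(KD, 𝓕)` with `κ_1 = κ((3^F·u)·P)` whose class
`κ_{ℓ}` has Kim's reading at `v₃`. The comparison maps are THE printed ones and their admissibility is the tree's theorem
(Mazur–Rubin Lemma 1.2.3); what stays displayed is «Kato's classes form this Kolyvagin system» (Kato + MR Thm. 3.2.4 /
5.2.12: print for `p ≥ 5`, OPEN at `3`; producer in the tree: THEOREM D `GaloisImage/KolyvaginSystemOfEulerSystem.lean` from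
an Euler system of `T_3E`) and «Kim's reading» (Thm. 3.13 + (5.3)). Nothing asserted; C-16 stays a CONJECTURE.
[cite: MazurRubin2004, Lemma 1.2.3, Thm. 3.2.4 and Thm. 5.2.12] [cite: Kim2022StructureSelmer, Thm. 3.13 and (5.3)]
[cite: Sakamoto2024, §2 (p. 921)] [cite: MilneADT2006, Ch. I, Thm. 4.10(b) and Thm. 2.8] -/
theorem kuriharaExactOrderRankOneAtThree_of_isKolyvaginSystem_canonical
    (hPT : poitouTate_sum_localTatePairing_eq_zero ℚ)
    (hEP : ∀ v : HeightOneSpectrum (𝓞 ℚ), localEulerPoincareCharacteristic (v.adicCompletion ℚ))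
    (hcore : ∀ (W : WeierstrassCurve ℚ) [W.IsElliptic] [W.IsGloballyMinimal],
      W.analyticRank = 1 →
      ∀ (P : W.toAffine.Point), ¬ IsOfFinAddOrder P →
        (∀ Q : W.toAffine.Point, ∃ n : ℤ, IsOfFinAddOrder (Q - n • P)) →
      (∀ T : W.toAffine.Point, 3 • T = 0 → T = 0) →
      W.HasSurjectiveModNGaloisRep 3 →
      W.HasGoodReductionAtPrime 3 → W.frobeniusTrace 3 ≠ 1 → W.frobeniusTrace 3 ≠ -2 →
      ¬ O5.PointLocallyThreeDivisibleAt W 3 P →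
      ∀ (q : ℚ) (s : ℕ), shaAn W = (q : ℂ) → padicValRat 3 q = s →
      ∀ {N : ℕ} [NeZero N] (D : ModularParametrizationData W N),
        ¬ (3 : ℤ) ∣ D.maninConstant →
        (∃ u : ℚ, ‖(u : ℚ_[3])‖ = 1 ∧ W.realPeriodRat = u * plusPeriod D.f) →
      ∀ (ℓ k : ℕ) [Fact ℓ.Prime], 1 ≤ k → Kato.IsKolyvaginPrime W 3 k ℓ →
        IsCyclicKolyvaginLevel W 3 ℓ →
      ∀ (vℓ v₃ : HeightOneSpectrum (𝓞 ℚ)), (ℓ : 𝓞 ℚ) ∈ vℓ.asIdeal → ((3 : ℕ) : 𝓞 ℚ) ∈ v₃.asIdeal →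
        ∀ ψ : (q : ℕ) → (ZMod q)ˣ →* Multiplicative (ZMod (3 ^ k)),
          (∀ q ∈ ℓ.primeFactors, Function.Surjective (ψ q)) →
            ∃ (k' : ℕ) (_ : k ≤ k' + 1) (_ : Kato.IsKolyvaginPrime W 3 (k' + 1) ℓ) (u : ℕ) (_ : ¬ 3 ∣ u)
              (S : Set (HeightOneSpectrum (𝓞 ℚ))) (τ : absoluteGaloisGroup ℚ)
              (_ : haveI : Fact (Nat.Prime 3) := ⟨Nat.prime_three⟩
                Nonempty (cokerSubOne (W.torsionGaloisModule (((3 : ℕ) : ℤ) ^ k' * ((3 : ℕ) : ℤ))) τ ≃+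
                  ZMod (3 ^ (k' + 1))))
              (_ : τ ∈ rootsOfUnityFixer ℚ (3 ^ (k' + 1)))
              (KD : KolyvaginDatum (W.torsionGaloisModule (((3 : ℕ) : ℤ) ^ k' * ((3 : ℕ) : ℤ))))
              (_ : KD.primes ⊆ frobeniusClassPrimes (W.torsionGaloisModule (((3 : ℕ) : ℤ) ^ k' * ((3 : ℕ) : ℤ)))
                S τ (3 ^ (k' + 1)))
              (ηr : (q : HeightOneSpectrum (𝓞 ℚ)) → (ZMod (Ideal.absNorm q.asIdeal))ˣ)
              (_ : haveI : Fact (Nat.Prime 3) := ⟨Nat.prime_three⟩; KD.HasCanonicalComparison (3 ^ (k' + 1)) ηr)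
              (_ : vℓ ∈ KD.primes)
              (hdiv : ∀ X : geomPoints W, ∃ R : geomPoints W, (((3 : ℕ) : ℤ) ^ k' * ((3 : ℕ) : ℤ)) • R = X)
              (𝓕 : SelmerStructure (W.torsionGaloisModule (((3 : ℕ) : ℤ) ^ k' * ((3 : ℕ) : ℤ))))
              (_ : ∀ v : Place ℚ, v ≠ Sum.inr vℓ → v ≠ Sum.inr v₃ →
                𝓕 v ≤ W.kummerSelmerStructure (((3 : ℕ) : ℤ) ^ k' * ((3 : ℕ) : ℤ)) v)
              (κ : Finset (HeightOneSpectrum (𝓞 ℚ)) →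
                galoisCohomology (W.torsionGaloisModule (((3 : ℕ) : ℤ) ^ k' * ((3 : ℕ) : ℤ))) 1)
              (_ : KD.IsKolyvaginSystem 𝓕 κ)
              (_ : κ ∅ = kummerMapTorsion W (((3 : ℕ) : ℤ) ^ k' * ((3 : ℕ) : ℤ)) hdiv
                ((3 ^ (s + padicValNat 3 W.tamagawaProduct) * u) • P)),
              ∀ ψp : galoisCohomology ((W.torsionGaloisModule (((3 : ℕ) : ℤ) ^ k' * ((3 : ℕ) : ℤ))).toLocal
                    (Sum.inr v₃)) 1 ⧸
                  W.kummerSelmerStructure (((3 : ℕ) : ℤ) ^ k' * ((3 : ℕ) : ℤ)) (Sum.inr v₃) ≃+ ZMod (3 ^ (k' + 1)),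
                (haveI : NeZero ℓ := ⟨(Fact.out : ℓ.Prime).ne_zero⟩
                 zmodPowOrd 3 k (kuriharaNumber D.f (3 ^ k) ℓ ψ)) =
                  min k (zmodPowOrd 3 (k' + 1) (ψp (galoisCohomology.localization
                    (W.torsionGaloisModule (((3 : ℕ) : ℤ) ^ k' * ((3 : ℕ) : ℤ))) (Sum.inr v₃) 1 (κ {vℓ}))))) :
    KuriharaExactOrderRankOneAtThree :=
  haveI h3 : Fact (Nat.Prime 3) := ⟨Nat.prime_three⟩
  kuriharaExactOrderRankOneAtThree_of_kolyvaginKimDatum hPT hEP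
    fun W _ _ hr P hP hgen htors hsurj hgood ha1 ha2 hm0 q s hq hs N _ D hManin hper ℓ k _ hk hKP hcyc vℓ v₃ hvℓ hv₃
      ψ hψ => by
      obtain ⟨k', hkn, hKPn, u, hu, S, τ, hτq, hτμ, KD, hPr, ηr, hD, hDℓ, hdiv, 𝓕, h𝓕, κ, hκ, h1, hkim⟩ :=
        hcore W hr P hP hgen htors hsurj hgood ha1 ha2 hm0 q s hq hs D hManin hper ℓ k hk hKP hcyc vℓ v₃ hvℓ hv₃ ψ hψ
      obtain ⟨hpv, hgoodℓ⟩ := IsKolyvaginPrime.not_mem_and_hasGoodReductionAt W hKPn hvℓ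
      exact ⟨k' + 1, hkn, hKPn, u, hu, kolyvaginKimDatum_of_isKolyvaginSystem_canonical W D.f 3 ℓ k k' _ vℓ v₃ ψ S
        hτq hτμ hPr hD hDℓ hdiv hpv hgoodℓ h𝓕 hκ h1 hkim⟩

end Closed

end Summit.BirchSwinnertonDyer.Rank1Residual.Ordinary

end
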